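import Mathlib
import HarnessLib
import Literature.AlgebraicGeometry.Resolution.KiralyLutkebohmert

/-!
# S1a — (T2a) the ABSTRACT ONE-SHOT KILL LEMMA (augmentation ideal of the lifted automorphism = `(e)`)

[OURS · L1 W4.5c · lead-1 g6, after plan-1 g11's SIG `L/w45c/W45cT2Signatures.lean` f384756d9d5bd870 (T2a) and memo
`L/w45c/T2-THEOREM-SHEET.md` §3] — NOT a statement of the manuscript; counted 0; AI-level work, weaker than expert review.
Crux stmt-ResolutionOfSingularities-17941 (`WildQuotients.CyclicQuotientFourfolds`), line `s1a-logminvertex` v6, stub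
`stub_winningStrategy` ((R0) one-shot branch of the termination argument).

**`augmentationIdeal_eq_span_of_oneShot`** = plan-1's `OneShotKillSig.AbstractOneShotKill` PROVED (and
`abstractOneShotKill` restates it in the sheet's ∀-form): for a ring map `B → C` with compatible automorphisms `σ`, `τ`,
elements `g i` generating the unit ideal of `C` with `g i * e ^ (w i)` in the extension of the augmentation ideal of `σ`
(`0 < w i`), gr-triviality `τ x − x ∈ (e)`, and every index a HEAD (`w i = 1`) or a UNIT SUCCESSOR
(`τ (g h) − g h − u * g i * e ∈ (e²)`, `u` a unit modulo `e`), one has `augmentationIdeal τ = (e)`.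
Proof: `⊆` from gr-triviality; `⊇`: the conductor `J = (I_τ : e)` is the unit ideal — if a maximal `𝔪 ⊇ J` existed,
pick `g i ∉ 𝔪`; a head gives `g i ∈ J`, a successor gives `u g i + x e ∈ J` which forces `u ∈ 𝔪 ∋ e`, `1 ∈ 𝔪`, when
`e ∈ 𝔪`, while `e ∉ 𝔪` gives `g i e^{w i − 1} ∈ J ⊆ 𝔪`, `g i ∈ 𝔪`.
-/

set_option linter.dupNamespace false

noncomputable section

open Literature.AlgebraicGeometry.Resolution

namespace Summit.ResolutionOfSingularities.ResolutionOfSingularities.Theorems.WildQuotientResolution.S1.OneShotKill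

universe u

variable {B C : Type u} [CommRing B] [CommRing C] [Algebra B C]

/-- The augmentation ideal of `σ` extends into the augmentation ideal of a compatible `τ`. -/
theorem map_augmentationIdeal_le (σ : B ≃+* B) (τ : C ≃+* C)
    (hcompat : ∀ b : B, τ (algebraMap B C b) = algebraMap B C (σ b)) :
    (augmentationIdeal σ).map (algebraMap B C) ≤ augmentationIdeal τ := by
  rw [augmentationIdeal, Ideal.map_span, Ideal.span_le]
  rintro _ ⟨_, ⟨b, rfl⟩, rfl⟩
  rw [map_sub, ← hcompat]
  exact sub_mem_augmentationIdeal τ _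

/-- gr-triviality bounds the augmentation ideal: `τ x − x ∈ (e)` for all `x` gives `I_τ ≤ (e)`. -/
theorem augmentationIdeal_le_span (τ : C ≃+* C) (e : C) (hgr : ∀ x : C, τ x - x ∈ Ideal.span {e}) :
    augmentationIdeal τ ≤ Ideal.span {e} := by
  rw [augmentationIdeal, Ideal.span_le]
  rintro _ ⟨x, rfl⟩
  exact hgr x

/-- **(T2a) THE ABSTRACT ONE-SHOT KILL LEMMA.** [OURS · L1 W4.5c] -/
theorem augmentationIdeal_eq_span_of_oneShot (σ : B ≃+* B) (τ : C ≃+* C)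
    (hcompat : ∀ b : B, τ (algebraMap B C b) = algebraMap B C (σ b))
    {ι : Type*} (g : ι → C) (w : ι → ℕ) (e : C)
    (hcov : Ideal.span (Set.range g) = ⊤)
    (hcentre : ∀ i, 0 < w i ∧ g i * e ^ (w i) ∈ (augmentationIdeal σ).map (algebraMap B C))
    (hgr : ∀ x : C, τ x - x ∈ Ideal.span {e})
    (hsucc : ∀ i, w i = 1 ∨ ∃ (h : ι) (u : C), IsUnit (Ideal.Quotient.mk (Ideal.span {e}) u) ∧
        τ (g h) - g h - u * g i * e ∈ Ideal.span {e ^ 2}) :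
    augmentationIdeal τ = Ideal.span {e} := by
  classical
  refine le_antisymm (augmentationIdeal_le_span τ e hgr) ?_
  rw [Ideal.span_singleton_le_iff_mem]
  -- the conductor `J = (I_τ : e)`
  let J : Ideal C := (augmentationIdeal τ).colon {e}
  have hJ : ∀ c : C, c ∈ J ↔ c * e ∈ augmentationIdeal τ := fun c => by
    rw [Submodule.mem_colon_singleton, smul_eq_mul]
  by_contra he
  have hJtop : J ≠ ⊤ := by
    intro h
    have h1 : (1 : C) ∈ J := by rw [h]; trivial
    rw [hJ, one_mul] at h1
    exact he h1
  obtain ⟨𝔪, h𝔪, hJ𝔪⟩ := Ideal.exists_le_maximal J hJtop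
  -- some `g i ∉ 𝔪`
  have hgi : ∃ i, g i ∉ 𝔪 := by
    by_contra hall
    push Not at hall
    have : Ideal.span (Set.range g) ≤ 𝔪 := by
      rw [Ideal.span_le]; rintro _ ⟨i, rfl⟩; exact hall i
    rw [hcov, top_le_iff] at this
    exact h𝔪.ne_top this
  obtain ⟨i, hi⟩ := hgi
  have hgie : g i * e ^ (w i) ∈ augmentationIdeal τ := map_augmentationIdeal_le σ τ hcompat (hcentre i).2
  -- if `e ∉ 𝔪`, then `g i e^{w i - 1} ∈ J ⊆ 𝔪` forces `g i ∈ 𝔪`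
  by_cases hem : e ∈ 𝔪
  swap
  · have hk : w i = (w i - 1) + 1 := (Nat.sub_add_cancel (hcentre i).1).symm
    have hmem : g i * e ^ (w i - 1) ∈ J := by
      rw [hJ, mul_assoc, ← pow_succ, ← hk]; exact hgie
    have := hJ𝔪 hmem
    rcases h𝔪.isPrime.mem_or_mem this with h1 | h2
    · exact hi h1
    · exact hem (h𝔪.isPrime.mem_of_pow_mem _ h2)
  -- `e ∈ 𝔪`: heads and unit successors
  rcases hsucc i with hhead | ⟨h, u, hu, hrel⟩
  · -- head: `g i * e ∈ I_τ`, so `g i ∈ J ⊆ 𝔪`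
    have hmem : g i ∈ J := by rw [hJ, ← pow_one e, ← hhead]; exact hgie
    exact hi (hJ𝔪 hmem)
  · -- unit successor: `τ (g h) - g h = u g i e + x e²`
    obtain ⟨x, hx⟩ := Ideal.mem_span_singleton'.mp hrel
    have hmem : u * g i + x * e ∈ J := by
      rw [hJ]
      have : (u * g i + x * e) * e = τ (g h) - g h := by
        rw [add_mul, mul_assoc x, ← pow_two, hx]; ring
      rw [this]
      exact sub_mem_augmentationIdeal τ _
    have h1 : u * g i + x * e ∈ 𝔪 := hJ𝔪 hmem
    have h2 : u * g i ∈ 𝔪 := by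
      have := 𝔪.sub_mem h1 (𝔪.mul_mem_left x hem)
      rwa [add_sub_cancel_right] at this
    have hu𝔪 : u ∈ 𝔪 := (h𝔪.isPrime.mem_or_mem h2).resolve_right hi
    -- `u` is a unit modulo `e ∈ 𝔪`: contradiction
    obtain ⟨v', hv'⟩ := hu.exists_right_inv
    obtain ⟨v, rfl⟩ := Ideal.Quotient.mk_surjective v'
    rw [← map_mul, ← map_one (Ideal.Quotient.mk (Ideal.span {e})), Ideal.Quotient.eq] at hv'
    have h3 : u * v - 1 ∈ 𝔪 := (Ideal.span_singleton_le_iff_mem 𝔪).mpr hem hv'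
    have h4 : (1 : C) ∈ 𝔪 := by
      have := 𝔪.sub_mem (𝔪.mul_mem_right v hu𝔪) h3
      rwa [sub_sub_cancel] at this
    exact h𝔪.ne_top ((Ideal.eq_top_iff_one 𝔪).mpr h4)

/-- (T2a) in the ∀-form of plan-1's signature sheet (`OneShotKillSig.AbstractOneShotKill`, finite index type). -/
theorem abstractOneShotKill (B C : Type u) [CommRing B] [CommRing C] [Algebra B C] (σ : B ≃+* B) (τ : C ≃+* C)
    (hcompat : ∀ b : B, τ (algebraMap B C b) = algebraMap B C (σ b))
    (ι : Type) [Finite ι] (g : ι → C) (w : ι → ℕ) (e : C)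
    (hcov : Ideal.span (Set.range g) = ⊤)
    (hcentre : ∀ i, 0 < w i ∧ g i * e ^ (w i) ∈ (augmentationIdeal σ).map (algebraMap B C))
    (hgr : ∀ x : C, τ x - x ∈ Ideal.span {e})
    (hsucc : ∀ i, w i = 1 ∨ ∃ (h : ι) (u : C), IsUnit (Ideal.Quotient.mk (Ideal.span {e}) u) ∧
        τ (g h) - g h - u * g i * e ∈ Ideal.span {e ^ 2}) :
    augmentationIdeal τ = Ideal.span {e} :=
  augmentationIdeal_eq_span_of_oneShot σ τ hcompat g w e hcov hcentre hgr hsucc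

end Summit.ResolutionOfSingularities.ResolutionOfSingularities.Theorems.WildQuotientResolution.S1.OneShotKill

end
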